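import Literature.MathematicalPhysics.QuantumLattice.DWaveSourceNNNHoppingWindowCertificateKKT
import HarnessLib

/-!
# Sourced `t–t'` window certificates with a KKT block and a TWO-SIDED energy window

Topic `Literature/MathematicalPhysics/QuantumLattice`. Everything here is PROVED; no definition and no
named fact is introduced. Sequel of `DWaveSourceNNNHoppingWindowCertificateKKT`
(`re_orbitState_ge_of_sourced_window_certificate_d4_TT'_kkt_ineq`: ONE identity in the window algebra
`𝔄_{Λ'}` — SOS, commutators with the sourced window Hamiltonian `H^{src,tt'}_{Λ'}`, affine-`D₄` defects over
`S ⊆ ker χ_{B₁g}`, `S^z`-charged words, anti-Hermitian parts, residual words, a state-optimality block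
`kktForm H^{src,tt'}_{Λ'} G (Γ(incl) ∘ B)` with `G ⪰ 0` and ARBITRARY generators, and ONE energy term
`κ (u·1 − E^{src,tt'})` with `κ, u` arbitrary reals — read in the orbit state of every `S^z`-eigenvector
GROUND vector of the pair-sourced torus `A_L = dWaveSourceTorusTT' L tp U μ h`).

WHAT IS ADDED. The energy WINDOW of a one-point program has two sides: a certified CEILING `E₀(A_L)/L² ≤ u`
(a trial-state row, Wang et al. 2024 §III) and a certified FLOOR `ℓ ≤ E₀(A_L)/L²` (an energy certificate of a
LARGER relaxation imported as a row into a smaller one-point program — the sourced `e_lo(h)` row of the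
pinning-field menus). The identity then carries `κ⁺ (u·1 − E^{src,tt'}) + κ⁻ (E^{src,tt'} − ℓ·1)` with
`κ⁺, κ⁻ ≥ 0`; since `κ⁺ (u·1 − E) + κ⁻ (E − ℓ·1) = (κ⁺u − κ⁻ℓ)·1 + (κ⁺ − κ⁻)(0·1 − E)`, the one-`κ` theorem
with `κ = κ⁺ − κ⁻`, cap `0` and constant `c + κ⁺u − κ⁻ℓ` gives
`c − Σₖ ‖aₖ‖ + κ⁺ (u − E₀/L²) + κ⁻ (E₀/L² − ℓ) ≤ Re ω̄_ψ(Γ(ι_{Λ',L}) X)`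
(`re_orbitState_ge_of_sourced_window_certificate_d4_TT'_kkt_two_sided_ineq`), hence `c − Σₖ ‖aₖ‖ ≤ Re ω̄_ψ(Γ X)`
under `E₀/L² ≤ u`, `ℓ ≤ E₀/L²` (`…_kkt_of_energy_window`). The cells and the one-point response leaves with
q-slotted energy rows are in `Summits/Ventures/CertifiedManyBodySolver/Rows/SourcedTorusRowsOnePointKKTEnergy`.

Honest framing (cell hubbard-cq, wording W1): a finite-`h` response bound is a «finite-h response (certified)»
row at FIXED `μ`, NOT an order parameter and NOT a phase word. No certificate exists in this file.

## References
* J. Wang et al., *Certifying ground-state properties of many-body systems*, Phys. Rev. X 14 (2024) 031006,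
  §III (energy constraints as rows). [cite: WangEtAl2024, §III]
* M. Araújo et al., arXiv:2311.18707, §3.2 Prop. 11 (state-optimality / KKT block). [cite: AraujoEtAl2023, §3.2 Prop. 11]
* O. Bratteli, D. W. Robinson II (1997), Prop. 5.3.19, §6.2.4. [cite: BratteliRobinsonII1997, Prop. 5.3.19]
-/

noncomputable section

namespace Literature.MathematicalPhysics.QuantumLattice

open Matrix Finset HubbardWave0 Literature.Probability.LatticeModels
open Literature.MathematicalPhysics.QuantumManyBody.StateRelaxation
open scoped ComplexOrder BigOperators

section TorusSourced

variable {L : ℕ} [NeZero L]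

/-- (Local to this section, as in `DWaveSourceNNNHoppingWindowCertificateKKT`.) [folklore] -/
local instance (priority := high) instDecidableEqFermionTorusSrcTTKKTEW : DecidableEq (FermionTorus 2 L) :=
  LinearOrder.toDecidableEq

/-- **Two energy terms are one**: `X − c·1 − κ⁺(u·1 − E) − κ⁻(E − ℓ·1) = R` rewrites as
`X − (c + κ⁺u − κ⁻ℓ)·1 − (κ⁺ − κ⁻)(0·1 − E) = R` (linear algebra in a `ℂ`-module). [folklore] -/
private theorem cert_two_sided_energy_window {A : Type*} [AddCommGroup A] [Module ℂ A] (X one E R : A)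
    (c κp κm u ℓ : ℝ)
    (hcert : X - (c : ℂ) • one - ((κp : ℝ) : ℂ) • (((u : ℝ) : ℂ) • one - E) -
        ((κm : ℝ) : ℂ) • (E - ((ℓ : ℝ) : ℂ) • one) = R) :
    X - (((c + κp * u - κm * ℓ : ℝ)) : ℂ) • one -
        (((κp - κm : ℝ)) : ℂ) • ((((0 : ℝ) : ℝ) : ℂ) • one - E) = R := by
  rw [← hcert]
  push_cast
  module

/-- **Sourced `t–t'` window certificate with a KKT block and a TWO-SIDED energy window, inequality form.**
Data as in `re_orbitState_ge_of_sourced_window_certificate_d4_TT'_kkt_ineq` (regions `Λ ⊆ Λ'`, labels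
`S ∋ 1` closed under products with `χ_{B₁g} = 1`, SOS, commutators with `H^{src,tt'}_{Λ'}`, affine-`D₄` defects,
`S^z`-charged words, anti-Hermitian parts, residual words, `kktForm H^{src,tt'}_{Λ'} G (Γ(incl) ∘ B)` with `G ⪰ 0`
and ARBITRARY `B_b ∈ 𝔄_Λ`), except that the identity carries TWO energy terms
`κ⁺ (u·1 − E^{src,tt'}) + κ⁻ (E^{src,tt'} − ℓ·1)`, `κ⁺, κ⁻, u, ℓ` arbitrary reals,
`E^{src,tt'} = Γ(ι₀) e^{tt'} − μ (n_{0↑} + n_{0↓}) − h (Γ(incl) Φ₀ + (Γ(incl) Φ₀)ᴴ)`. Then for every `L ≥ 3`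
with `x ↦ x mod L` injective on `thicken Λ' 1` and every unit `S^z`-eigenvector ground vector `ψ` of
`A_L = dWaveSourceTorusTT' L tp U μ h`:
`c − Σₖ ‖aₖ‖ + κ⁺ (u − E₀/L²) + κ⁻ (E₀/L² − ℓ) ≤ Re ω̄_ψ(Γ(ι_{Λ',L}) X)`, `E₀ = groundEnergy A_L`.
[cite: WangEtAl2024, §III] [cite: AraujoEtAl2023, §3.2 Prop. 11] -/
theorem re_orbitState_ge_of_sourced_window_certificate_d4_TT'_kkt_two_sided_ineq (tp U μ h : ℝ) (hL : 3 ≤ L)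
    {M : ℝ} {Λ Λ' : Finset (Site 2)} (hΛ : Λ ⊆ Λ') (h8 : thicken Λ 1 ⊆ Λ')
    (h0 : thicken ({0} : Finset (Site 2)) 1 ⊆ Λ') (hz : (0 : Site 2) ∈ Λ')
    (hP : pairRegion (insert (0 : Site 2) unitSteps) 0 ⊆ Λ')
    (hInj : Set.InjOn (Torus.proj (d := 2) L) ↑(thicken Λ' 1))
    (hInj' : Set.InjOn (Torus.proj (d := 2) L) ↑Λ')
    {S : Finset (DihedralGroup 4)} (h1 : (1 : DihedralGroup 4) ∈ S) (hmul : ∀ a ∈ S, ∀ b ∈ S, a * b ∈ S)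
    (hS : ∀ γ ∈ S, b1gChar γ = 1)
    {ψ : Fock (Orb (FermionTorus 2 L))} (hψK : ψ ∈ fockSpinZSector (Λ := FermionTorus 2 L) M)
    (hψ1 : star ψ ⬝ᵥ ψ = 1)
    (hHψ : dWaveSourceTorusTT' L tp U μ h *ᵥ ψ =
      (((dWaveSourceTorusTT' L tp U μ h).groundEnergy : ℝ) : ℂ) • ψ)
    (Xw : FermionOp Λ') (κp κm u ℓ : ℝ)
    {m : Type*} [Fintype m] [DecidableEq m] {Λm : Matrix m m ℂ} (hΛm : Λm.PosSemidef)
    (O : m → FermionOp Λ')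
    {κ' : Type*} (s : Finset κ') (B : κ' → FermionOp Λ)
    {ι : Type*} (tt : Finset ι) (γ : ι → DihedralGroup 4) (hγS : ∀ l ∈ tt, γ l ∈ S) (wv : ι → Site 2)
    (hsh : ∀ l, d4ShiftSet (γ l) (wv l) Λ ⊆ Λ') (Y : ι → FermionOp Λ)
    {ρ : Type*} (uu : Finset ρ) (b : ρ → ℂ) (cw : ρ → List (Orb (PolySite Λ') × Bool))
    (hcw : ∀ j ∈ uu, ladderSpinCharge (cw j) ≠ 0)
    {δ : Type*} (ah : Finset δ) (dc : δ → ℝ) (V : δ → FermionOp Λ')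
    {κ'' : Type*} (w : Finset κ'') (a : κ'' → ℂ) (word : κ'' → List (Orb (PolySite Λ') × Bool))
    {β : Type*} [Fintype β] [DecidableEq β] {G : Matrix β β ℂ} (hG : G.PosSemidef)
    (Bk : β → FermionOp Λ) {c : ℝ}
    (hcert : Xw - (c : ℂ) • (1 : FermionOp Λ') -
        ((κp : ℝ) : ℂ) • (((u : ℝ) : ℂ) • (1 : FermionOp Λ') -
          (fermionEmbed (PolySite.incl h0) ((hubbardTTPrimeFermionInteraction 1 tp U).meanEnergyObs 1) -
            (μ : ℂ) • ∑ σ : Fin 2, nAt 0 hz σ -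
            (h : ℂ) • (fermionEmbed (PolySite.incl hP) (localPairAt (insert (0 : Site 2) unitSteps) dWaveFormFactor 0) +
              (fermionEmbed (PolySite.incl hP) (localPairAt (insert (0 : Site 2) unitSteps) dWaveFormFactor 0))ᴴ))) -
        ((κm : ℝ) : ℂ) • ((fermionEmbed (PolySite.incl h0) ((hubbardTTPrimeFermionInteraction 1 tp U).meanEnergyObs 1) -
            (μ : ℂ) • ∑ σ : Fin 2, nAt 0 hz σ -
            (h : ℂ) • (fermionEmbed (PolySite.incl hP) (localPairAt (insert (0 : Site 2) unitSteps) dWaveFormFactor 0) +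
              (fermionEmbed (PolySite.incl hP) (localPairAt (insert (0 : Site 2) unitSteps) dWaveFormFactor 0))ᴴ)) -
          ((ℓ : ℝ) : ℂ) • (1 : FermionOp Λ')) =
      gramForm Λm O +
        (∑ k ∈ s, (pairSourceWindowHamiltonianTT' dWaveFormFactor Λ' tp U μ h * fermionEmbed (PolySite.incl hΛ) (B k) -
            fermionEmbed (PolySite.incl hΛ) (B k) * pairSourceWindowHamiltonianTT' dWaveFormFactor Λ' tp U μ h) +
          ∑ l ∈ tt, (fermionEmbed (PolySite.incl (hsh l)) (fermionEmbed (PolySite.d4Emb (γ l) (wv l) Λ) (Y l)) -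
            fermionEmbed (PolySite.incl hΛ) (Y l)) +
          ∑ j ∈ uu, b j • ladderWord (cw j)) +
        (∑ m' ∈ ah, ((dc m' : ℝ) : ℂ) • ((V m')ᴴ - V m') + ∑ k ∈ w, a k • ladderWord (word k)) +
        kktForm (pairSourceWindowHamiltonianTT' dWaveFormFactor Λ' tp U μ h) G
          (fun b' => fermionEmbed (PolySite.incl hΛ) (Bk b'))) :
    c - ∑ k ∈ w, ‖a k‖ + κp * (u - (dWaveSourceTorusTT' L tp U μ h).groundEnergy / (L : ℝ) ^ 2) +
        κm * ((dWaveSourceTorusTT' L tp U μ h).groundEnergy / (L : ℝ) ^ 2 - ℓ) ≤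
      (orbitState (spaceGroupUnitary S) ψ (fermionEmbed (PolySite.toTorusEmb L hInj') Xw)).re := by
  -- the two energy terms are one energy term with `κ = κ⁺ − κ⁻`, cap `0` and constant `c + κ⁺u − κ⁻ℓ`
  have hcert' := cert_two_sided_energy_window Xw (1 : FermionOp Λ')
    (fermionEmbed (PolySite.incl h0) ((hubbardTTPrimeFermionInteraction 1 tp U).meanEnergyObs 1) -
      (μ : ℂ) • ∑ σ : Fin 2, nAt 0 hz σ -
      (h : ℂ) • (fermionEmbed (PolySite.incl hP) (localPairAt (insert (0 : Site 2) unitSteps) dWaveFormFactor 0) +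
        (fermionEmbed (PolySite.incl hP) (localPairAt (insert (0 : Site 2) unitSteps) dWaveFormFactor 0))ᴴ)) _
    c κp κm u ℓ hcert
  have hmain := re_orbitState_ge_of_sourced_window_certificate_d4_TT'_kkt_ineq tp U μ h hL hΛ h8 h0 hz hP hInj hInj'
    h1 hmul hS hψK hψ1 hHψ Xw (κp - κm) 0 hΛm O s B tt γ hγS wv hsh Y uu b cw hcw ah dc V w a word hG Bk hcert'
  have hring : c + κp * u - κm * ℓ - ∑ k ∈ w, ‖a k‖ +
      (κp - κm) * (0 - (dWaveSourceTorusTT' L tp U μ h).groundEnergy / (L : ℝ) ^ 2) =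
      c - ∑ k ∈ w, ‖a k‖ + κp * (u - (dWaveSourceTorusTT' L tp U μ h).groundEnergy / (L : ℝ) ^ 2) +
        κm * ((dWaveSourceTorusTT' L tp U μ h).groundEnergy / (L : ℝ) ^ 2 - ℓ) := by
    ring
  rw [hring] at hmain
  exact hmain

/-- **For every ground state, inside a certified two-sided energy window** (`κ⁺, κ⁻ ≥ 0`, a certified ceiling
`E₀/L² ≤ u` and a certified floor `ℓ ≤ E₀/L²`): under the hypotheses of
`re_orbitState_ge_of_sourced_window_certificate_d4_TT'_kkt_two_sided_ineq`, EVERY unit `S^z`-eigenvector ground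
vector `ψ` of the pair-sourced torus obeys `c − Σₖ ‖aₖ‖ ≤ Re ω̄_ψ(Γ(ι_{Λ',L}) X)` — the ground-state cell
`Summit.Ventures.CertifiedManyBodySolver.SourcedTorusCorrLowerRowGS` given an energy ceiling cell at `u` and an
energy floor cell at `ℓ`. [cite: WangEtAl2024, §III] [cite: AraujoEtAl2023, §3.2 Prop. 11] -/
theorem re_orbitState_ge_of_sourced_window_certificate_d4_TT'_kkt_of_energy_window (tp U μ h : ℝ) (hL : 3 ≤ L)
    {M : ℝ} {Λ Λ' : Finset (Site 2)} (hΛ : Λ ⊆ Λ') (h8 : thicken Λ 1 ⊆ Λ')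
    (h0 : thicken ({0} : Finset (Site 2)) 1 ⊆ Λ') (hz : (0 : Site 2) ∈ Λ')
    (hP : pairRegion (insert (0 : Site 2) unitSteps) 0 ⊆ Λ')
    (hInj : Set.InjOn (Torus.proj (d := 2) L) ↑(thicken Λ' 1))
    (hInj' : Set.InjOn (Torus.proj (d := 2) L) ↑Λ')
    {S : Finset (DihedralGroup 4)} (h1 : (1 : DihedralGroup 4) ∈ S) (hmul : ∀ a ∈ S, ∀ b ∈ S, a * b ∈ S)
    (hS : ∀ γ ∈ S, b1gChar γ = 1)
    {ψ : Fock (Orb (FermionTorus 2 L))} (hψK : ψ ∈ fockSpinZSector (Λ := FermionTorus 2 L) M)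
    (hψ1 : star ψ ⬝ᵥ ψ = 1)
    (hHψ : dWaveSourceTorusTT' L tp U μ h *ᵥ ψ =
      (((dWaveSourceTorusTT' L tp U μ h).groundEnergy : ℝ) : ℂ) • ψ)
    (Xw : FermionOp Λ') {κp κm u ℓ : ℝ} (hκp : 0 ≤ κp) (hκm : 0 ≤ κm)
    (hu : (dWaveSourceTorusTT' L tp U μ h).groundEnergy / (L : ℝ) ^ 2 ≤ u)
    (hℓ : ℓ ≤ (dWaveSourceTorusTT' L tp U μ h).groundEnergy / (L : ℝ) ^ 2)
    {m : Type*} [Fintype m] [DecidableEq m] {Λm : Matrix m m ℂ} (hΛm : Λm.PosSemidef)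
    (O : m → FermionOp Λ')
    {κ' : Type*} (s : Finset κ') (B : κ' → FermionOp Λ)
    {ι : Type*} (tt : Finset ι) (γ : ι → DihedralGroup 4) (hγS : ∀ l ∈ tt, γ l ∈ S) (wv : ι → Site 2)
    (hsh : ∀ l, d4ShiftSet (γ l) (wv l) Λ ⊆ Λ') (Y : ι → FermionOp Λ)
    {ρ : Type*} (uu : Finset ρ) (b : ρ → ℂ) (cw : ρ → List (Orb (PolySite Λ') × Bool))
    (hcw : ∀ j ∈ uu, ladderSpinCharge (cw j) ≠ 0)
    {δ : Type*} (ah : Finset δ) (dc : δ → ℝ) (V : δ → FermionOp Λ')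
    {κ'' : Type*} (w : Finset κ'') (a : κ'' → ℂ) (word : κ'' → List (Orb (PolySite Λ') × Bool))
    {β : Type*} [Fintype β] [DecidableEq β] {G : Matrix β β ℂ} (hG : G.PosSemidef)
    (Bk : β → FermionOp Λ) {c : ℝ}
    (hcert : Xw - (c : ℂ) • (1 : FermionOp Λ') -
        ((κp : ℝ) : ℂ) • (((u : ℝ) : ℂ) • (1 : FermionOp Λ') -
          (fermionEmbed (PolySite.incl h0) ((hubbardTTPrimeFermionInteraction 1 tp U).meanEnergyObs 1) -
            (μ : ℂ) • ∑ σ : Fin 2, nAt 0 hz σ -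
            (h : ℂ) • (fermionEmbed (PolySite.incl hP) (localPairAt (insert (0 : Site 2) unitSteps) dWaveFormFactor 0) +
              (fermionEmbed (PolySite.incl hP) (localPairAt (insert (0 : Site 2) unitSteps) dWaveFormFactor 0))ᴴ))) -
        ((κm : ℝ) : ℂ) • ((fermionEmbed (PolySite.incl h0) ((hubbardTTPrimeFermionInteraction 1 tp U).meanEnergyObs 1) -
            (μ : ℂ) • ∑ σ : Fin 2, nAt 0 hz σ -
            (h : ℂ) • (fermionEmbed (PolySite.incl hP) (localPairAt (insert (0 : Site 2) unitSteps) dWaveFormFactor 0) +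
              (fermionEmbed (PolySite.incl hP) (localPairAt (insert (0 : Site 2) unitSteps) dWaveFormFactor 0))ᴴ)) -
          ((ℓ : ℝ) : ℂ) • (1 : FermionOp Λ')) =
      gramForm Λm O +
        (∑ k ∈ s, (pairSourceWindowHamiltonianTT' dWaveFormFactor Λ' tp U μ h * fermionEmbed (PolySite.incl hΛ) (B k) -
            fermionEmbed (PolySite.incl hΛ) (B k) * pairSourceWindowHamiltonianTT' dWaveFormFactor Λ' tp U μ h) +
          ∑ l ∈ tt, (fermionEmbed (PolySite.incl (hsh l)) (fermionEmbed (PolySite.d4Emb (γ l) (wv l) Λ) (Y l)) -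
            fermionEmbed (PolySite.incl hΛ) (Y l)) +
          ∑ j ∈ uu, b j • ladderWord (cw j)) +
        (∑ m' ∈ ah, ((dc m' : ℝ) : ℂ) • ((V m')ᴴ - V m') + ∑ k ∈ w, a k • ladderWord (word k)) +
        kktForm (pairSourceWindowHamiltonianTT' dWaveFormFactor Λ' tp U μ h) G
          (fun b' => fermionEmbed (PolySite.incl hΛ) (Bk b'))) :
    c - ∑ k ∈ w, ‖a k‖ ≤
      (orbitState (spaceGroupUnitary S) ψ (fermionEmbed (PolySite.toTorusEmb L hInj') Xw)).re := by
  have hmain := re_orbitState_ge_of_sourced_window_certificate_d4_TT'_kkt_two_sided_ineq tp U μ h hL hΛ h8 h0 hz hP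
    hInj hInj' h1 hmul hS hψK hψ1 hHψ Xw κp κm u ℓ hΛm O s B tt γ hγS wv hsh Y uu b cw hcw ah dc V w a word hG Bk
    hcert
  have hslack₁ : 0 ≤ κp * (u - (dWaveSourceTorusTT' L tp U μ h).groundEnergy / (L : ℝ) ^ 2) :=
    mul_nonneg hκp (sub_nonneg.2 hu)
  have hslack₂ : 0 ≤ κm * ((dWaveSourceTorusTT' L tp U μ h).groundEnergy / (L : ℝ) ^ 2 - ℓ) :=
    mul_nonneg hκm (sub_nonneg.2 hℓ)
  linarith

end TorusSourced

end Literature.MathematicalPhysics.QuantumLattice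

end
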